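import Literature.AlgebraicGeometry.Frobenioids.EquivalenceUnitsStandardType
import Literature.AlgebraicGeometry.Frobenioids.EquivalenceUnitsFrobeniusSlim
import Literature.AlgebraicGeometry.Frobenioids.EquivalenceGroupLikeQuasiIsotropic
import Literature.AlgebraicGeometry.Frobenioids.Thm34Sub
import HarnessLib

/-!
# Frobenioids I, Theorem 3.4 (iv), first clause «`Ψ` preserves `O^▷(−)`, `O^×(−)`» under (a), (b), (c)
# AS STATED over FSM-type bases — all inputs instantiated (proof-only)

Mochizuki, *The geometry of Frobenioids I: the general theory*, Kyushu J. Math. **62** (2008)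
293–400, Thm. 3.4 (iv) p. 62 l. 36 – p. 63 l. 4 [cite: MochizukiFrdI2008, Thm. 3.4 (iv) p.63].

PROOF-ONLY file (abc-iut cell, sub-node `FrdI:Thm3.4(iv)/L08 UnitsDivisorsPreserved`, seat abc-iut-w4-d093):
the case-split closer `FrdI.thm34iv_units_of_core` (`EquivalenceUnitsStandardType.lean`) with its three inputs
supplied by landed theorems — the core transport theorem `PreFrobenioid.map_mem_endSubmonoid_of_isFrobeniusSlim`
(`EquivalenceUnitsFrobeniusSlim.lean`, printed route p. 66 via Prop. 3.3 (i)) and, in group-like type, the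
Thm. 3.4 (iii) morphism list under (b) of seat abc-iut-w4-d088 (`FrdI.thm34iii_of_isOfGroupLikeType_of_hypB`,
`EquivalenceGroupLikeQuasiIsotropic.lean`, for `Ψ` and for `Ψ⁻¹`). Result: `FrdI.thm34iv_units` — hypotheses
(a) `C₁`, `C₂` Frobenioids of standard type over FSM-type bases (the cell's repaired base hypothesis), (b)
`HypB`, (c) `D₂` Frobenius-slim; conclusion the first two conjuncts of the typed `PreFrobenioidData.Thm34iv`
at `ofFunctor`; and `FrdI.l08_unitsDivisorsPreserved : Thm34Sub.L08_UnitsDivisorsPreserved F₁ F₂ Ψ` — the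
sub-DAG slot of abc-iut-L1-d8's `Thm34Sub.lean` AS TYPED (its extra hypothesis "`D₁` Frobenius-slim" is not
needed). Nothing of [FrdI] is restated as a named fact; no statement of the paper is strengthened.
-/

namespace Literature.AlgebraicGeometry.Frobenioids

open CategoryTheory Opposite

namespace FrdI

universe w v v' u u'

variable {D₁ : Type u} [Category.{v} D₁] {Φ₁ : D₁ᵒᵖ ⥤ CommMonCat.{w}} {C₁ : Type u'} [Category.{v'} C₁]
  {D₂ : Type u} [Category.{v} D₂] {Φ₂ : D₂ᵒᵖ ⥤ CommMonCat.{w}} {C₂ : Type u'} [Category.{v'} C₂]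
  {F₁ : C₁ ⥤ ElemFrobenioid Φ₁} {F₂ : C₂ ⥤ ElemFrobenioid Φ₂}

/-- Hypothesis (b) of Thm. 3.4 is symmetric: it holds for `Ψ⁻¹` if it holds for `Ψ`.
[cite: MochizukiFrdI2008, Thm. 3.4 (iii) p.62] -/
theorem hypB_symm {Ψ : C₁ ≌ C₂}
    (hB : PreFrobenioidData.HypB (PreFrobenioidData.ofFunctor Φ₁ F₁) (PreFrobenioidData.ofFunctor Φ₂ F₂) Ψ) :
    PreFrobenioidData.HypB (PreFrobenioidData.ofFunctor Φ₂ F₂) (PreFrobenioidData.ofFunctor Φ₁ F₁) Ψ.symm :=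
  fun h₂ h₁ => ⟨(hB h₁ h₂).2, (hB h₁ h₂).1⟩

/-- **[FrdI] Thm. 3.4 (iv), first clause** (abc-iut node `FrdI:Thm3.4(iv)`, sub-node L08): for Frobenioids
`C₁`, `C₂` of standard type over FSM-type bases, with (b) `HypB` and (c) `D₂` Frobenius-slim, the equivalence
`Ψ` carries `O^▷(A)` into `O^▷(Ψ A)` and `O^×(A)` into `O^×(Ψ A)` for every object `A` — all inputs instantiated
by landed theorems (Thm. 3.4 (ii)/(iii) over FSM-type bases; the group-like-type morphism list under (b); the
Prop. 3.3 (i) transport theorem). [cite: MochizukiFrdI2008, Thm. 3.4 (iv) p.63] -/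
theorem thm34iv_units (hF₁ : PreFrobenioid.IsFrobenioid F₁) (hF₂ : PreFrobenioid.IsFrobenioid F₂)
    (hs₁ : (PreFrobenioidData.ofFunctor Φ₁ F₁).IsOfStandardType)
    (hs₂ : (PreFrobenioidData.ofFunctor Φ₂ F₂).IsOfStandardType) (hD₁ : IsOfFSMType D₁) (hD₂ : IsOfFSMType D₂)
    (Ψ : C₁ ≌ C₂)
    (hB : PreFrobenioidData.HypB (PreFrobenioidData.ofFunctor Φ₁ F₁) (PreFrobenioidData.ofFunctor Φ₂ F₂) Ψ)
    (hslim₂ : IsFrobeniusSlim D₂) :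
    (∀ (A : C₁) (α : End A), α ∈ (PreFrobenioidData.ofFunctor Φ₁ F₁).endSubmonoid A →
        Ψ.functor.map α ∈ (PreFrobenioidData.ofFunctor Φ₂ F₂).endSubmonoid (Ψ.functor.obj A)) ∧
      ∀ (A : C₁) (α : Aut A), α ∈ (PreFrobenioidData.ofFunctor Φ₁ F₁).unitsSubgroup A →
        Ψ.functor.mapIso α ∈ (PreFrobenioidData.ofFunctor Φ₂ F₂).unitsSubgroup (Ψ.functor.obj A) :=
  thm34iv_units_of_core hF₁ hF₂ hs₁ hs₂ hD₁ hD₂ Ψ hB hslim₂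
    (fun hbi hpb' _ hFN hsl _ f hf =>
      PreFrobenioid.map_mem_endSubmonoid_of_isFrobeniusSlim hF₁ hF₂ hFN hsl Ψ hbi hpb' f hf)
    (fun hG₁ hG₂ =>
      (thm34iii_of_isOfGroupLikeType_of_hypB hF₁ hF₂ hs₁.quasiIsotropic hs₂.quasiIsotropic hG₁ hG₂ Ψ hB).1.2.1)
    (fun hG₁ hG₂ =>
      (thm34iii_of_isOfGroupLikeType_of_hypB hF₂ hF₁ hs₂.quasiIsotropic hs₁.quasiIsotropic hG₂ hG₁ Ψ.symm
        (hypB_symm hB)).1.2.2.2.2.1)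

/-- **Sub-DAG slot `FrdI:Thm3.4(iv)/L08 UnitsDivisorsPreserved` AS TYPED** (`FrdI.Thm34Sub.L08_UnitsDivisorsPreserved`,
abc-iut-L1-d8's statements file): DISCHARGED by `thm34iv_units`. [cite: MochizukiFrdI2008, Thm. 3.4 (iv) p.63] -/
theorem l08_unitsDivisorsPreserved (Ψ : C₁ ≌ C₂) : Thm34Sub.L08_UnitsDivisorsPreserved F₁ F₂ Ψ :=
  fun h _ hs₂ => thm34iv_units h.isFrobenioid₁ h.isFrobenioid₂ h.standard₁ h.standard₂ h.fsm₁ h.fsm₂ Ψ h.hypB hs₂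

end FrdI

end Literature.AlgebraicGeometry.Frobenioids
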